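import Literature.MathematicalPhysics.QuantumManyBody.BoseGasProductState
import HarnessLib

/-!
# Crux `OneBodyEntropyBound` (stmt-AtomisticToContinuum-13440), line `registered`: stub `stub_symmCount`

Route `BECCellInformation`, problem `BoseEinsteinCondensation` of the summit `AtomisticToContinuum`;
support file for the line's skeleton (namespace `…Cruxes.OneBodyEntropyBound.Birth`).

**Statement** (`stub_symmCount`, SYMMETRISED COUNTING). Let `Ψ` be an `(n+1)`-boson wave function,
`A ⊆ ℝ³` measurable, `R` a distance and `γ ≥ 0`. Call particle `i` of a configuration `X`
*isolated in `A`* if `X i ∈ A` and every other particle of `A` is at distance `≥ R` from `X i`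
(the event `iso i = {X | X i ∈ A ∧ ∀ i' ≠ i, X i' ∈ A → R ≤ |X i − X i'|}`), and *non-isolated in
`A`* if `X i ∈ A` and some other particle of `A` is at distance `< R`
(`nonIso i = {X | X i ∈ A ∧ ∃ i' ≠ i, X i' ∈ A ∧ |X i − X i'| < R}`). If EVERY configuration has at
most `γ` particles isolated in `A`, then
`(n+1) · P(X 0 ∈ A) ≤ (n+1) · P(particle 0 is non-isolated in A) + γ`
(probabilities in the state `|Ψ|² dX`, written as lower Lebesgue integrals of indicators; the
event `nonIso 0` is written with the other particles indexed by `j.succ`, `j : Fin n`).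

**Proof.** Pointwise, a particle of `A` is isolated or not, so
`Σ_i 1_A(X i) ≤ Σ_i 1_{nonIso i}(X) + Σ_i 1_{iso i}(X) ≤ Σ_i 1_{nonIso i}(X) + γ`.
Multiply by `|Ψ(X)|²` and integrate (`∫ |Ψ|² = 1`). By Bose symmetry and the relabelling invariance
of Lebesgue measure (`lintegral_comp_perm` with the transposition `(0 i)`), every summand on either
side equals the one for particle `0`, whence the factors `n+1`. Finally the particles `≠ 0` of
`Fin (n+1)` are exactly the successors `j.succ`, `j : Fin n`. No auxiliary definitions: the two
events are written out as set-builder expressions throughout.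
-/

noncomputable section

namespace Summit.AtomisticToContinuum.BoseEinsteinCondensation.Cruxes.OneBodyEntropyBound.Birth

open MeasureTheory Set
open scoped ENNReal NNReal
open Literature.MathematicalPhysics.QuantumManyBody.BoseGas

namespace SymmCount

section Events

variable {N : ℕ}

/-- Pointwise: `1_A(X i) ≤ 1_{nonIso i}(X) + 1_{iso i}(X)` (a particle of `A` is isolated or not).
[folklore] -/
theorem indicator_apply_le (A : Set Space) (R : ℝ) (i : Fin N) (X : Config N) :
    A.indicator (fun _ => (1 : ℝ≥0∞)) (X i) ≤
      {X : Config N | X i ∈ A ∧ ∃ i', i' ≠ i ∧ X i' ∈ A ∧ dist (X i) (X i') < R}.indicator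
          (fun _ => (1 : ℝ≥0∞)) X +
        {X : Config N | X i ∈ A ∧ ∀ i', i' ≠ i → X i' ∈ A → R ≤ dist (X i) (X i')}.indicator
          (fun _ => (1 : ℝ≥0∞)) X := by
  by_cases hA : X i ∈ A
  · rw [indicator_of_mem hA]
    by_cases hiso : X ∈ {X : Config N | X i ∈ A ∧ ∀ i', i' ≠ i → X i' ∈ A → R ≤ dist (X i) (X i')}
    · rw [indicator_of_mem hiso]
      exact le_add_self
    · have hni : X ∈ {X : Config N | X i ∈ A ∧ ∃ i', i' ≠ i ∧ X i' ∈ A ∧ dist (X i) (X i') < R} := by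
        refine ⟨hA, ?_⟩
        by_contra h
        simp only [not_exists, not_and, not_lt] at h
        exact hiso ⟨hA, fun i' hi' hAi' => h i' hi' hAi'⟩
      rw [indicator_of_mem hni]
      exact le_self_add
  · rw [indicator_of_notMem hA]
    exact bot_le

/-- Summed over the particles: `Σ_i 1_A(X i) ≤ Σ_i 1_{nonIso i}(X) + Σ_i 1_{iso i}(X)`. [folklore] -/
theorem sum_indicator_apply_le (A : Set Space) (R : ℝ) (X : Config N) :
    ∑ i, A.indicator (fun _ => (1 : ℝ≥0∞)) (X i) ≤
      ∑ i, {X : Config N | X i ∈ A ∧ ∃ i', i' ≠ i ∧ X i' ∈ A ∧ dist (X i) (X i') < R}.indicator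
          (fun _ => (1 : ℝ≥0∞)) X +
        ∑ i, {X : Config N | X i ∈ A ∧ ∀ i', i' ≠ i → X i' ∈ A → R ≤ dist (X i) (X i')}.indicator
          (fun _ => (1 : ℝ≥0∞)) X := by
  rw [← Finset.sum_add_distrib]
  exact Finset.sum_le_sum fun i _ => indicator_apply_le A R i X

/-- The event `nonIso i` is measurable (for measurable `A`): a finite Boolean combination of
coordinate preimages of `A` and open distance conditions. [folklore] -/
theorem measurableSet_nonIso {A : Set Space} (hA : MeasurableSet A) (R : ℝ) (i : Fin N) :
    MeasurableSet {X : Config N | X i ∈ A ∧ ∃ i', i' ≠ i ∧ X i' ∈ A ∧ dist (X i) (X i') < R} := by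
  have h : {X : Config N | X i ∈ A ∧ ∃ i', i' ≠ i ∧ X i' ∈ A ∧ dist (X i) (X i') < R} =
      (fun X : Config N => X i) ⁻¹' A ∩ ⋃ i' : Fin N, ⋃ (_ : i' ≠ i),
        ((fun X : Config N => X i') ⁻¹' A ∩ {X : Config N | dist (X i) (X i') < R}) := by
    ext X
    simp only [mem_setOf_eq, mem_inter_iff, mem_preimage, mem_iUnion, exists_prop]
  rw [h]
  exact (measurable_pi_apply i hA).inter (MeasurableSet.iUnion fun i' =>
    MeasurableSet.iUnion fun _ => (measurable_pi_apply i' hA).inter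
      (measurableSet_lt ((continuous_apply i).dist (continuous_apply i')).measurable
        measurable_const))

end Events

/-- Relabelling by the transposition `(0 i)`: `X ∘ (0 i) ∈ nonIso 0 ↔ X ∈ nonIso i`. [folklore] -/
theorem comp_swap_mem_nonIso_iff {n : ℕ} (A : Set Space) (R : ℝ) (i : Fin (n + 1))
    (X : Config (n + 1)) :
    X ∘ Equiv.swap 0 i ∈ {X : Config (n + 1) | X 0 ∈ A ∧
        ∃ i', i' ≠ 0 ∧ X i' ∈ A ∧ dist (X 0) (X i') < R} ↔
      X ∈ {X : Config (n + 1) | X i ∈ A ∧ ∃ i', i' ≠ i ∧ X i' ∈ A ∧ dist (X i) (X i') < R} := by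
  simp only [mem_setOf_eq, Function.comp_apply, Equiv.swap_apply_left]
  refine and_congr_right fun _ => ⟨?_, ?_⟩
  · rintro ⟨i', hi', hA', hd⟩
    refine ⟨Equiv.swap 0 i i', fun h => hi' ?_, hA', hd⟩
    have h' := congrArg (Equiv.swap (0 : Fin (n + 1)) i) h
    rwa [Equiv.swap_apply_self, Equiv.swap_apply_right] at h'
  · rintro ⟨i', hi', hA', hd⟩
    refine ⟨Equiv.swap 0 i i', fun h => hi' ?_, ?_, ?_⟩
    · have h' := congrArg (Equiv.swap (0 : Fin (n + 1)) i) h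
      rwa [Equiv.swap_apply_self, Equiv.swap_apply_left] at h'
    · rwa [Equiv.swap_apply_self]
    · rwa [Equiv.swap_apply_self]

/-- The event `nonIso 0` in the successor form of the skeleton: the particles `≠ 0` of `Fin (n+1)`
are the `j.succ`, `j : Fin n`. [folklore] -/
theorem nonIso_zero_eq {n : ℕ} (A : Set Space) (R : ℝ) :
    {X : Config (n + 1) | X 0 ∈ A ∧ ∃ i', i' ≠ 0 ∧ X i' ∈ A ∧ dist (X 0) (X i') < R} =
      {X : Config (n + 1) | X 0 ∈ A ∧ ∃ j : Fin n, X j.succ ∈ A ∧ dist (X 0) (X j.succ) < R} := by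
  ext X
  simp only [mem_setOf_eq]
  refine and_congr_right fun _ => ⟨?_, ?_⟩
  · rintro ⟨i', hi', hA', hd⟩
    obtain ⟨j, rfl⟩ := Fin.exists_succ_eq_of_ne_zero hi'
    exact ⟨j, hA', hd⟩
  · rintro ⟨j, hA', hd⟩
    exact ⟨j.succ, Fin.succ_ne_zero j, hA', hd⟩

section State

variable {n : ℕ} {L : ℝ}

/-- **Bose symmetry**: `∫ 1_A(X i) |Ψ|² = ∫ 1_A(X 0) |Ψ|²`. [folklore] -/
theorem lintegral_indicator_apply_eq (Ψ : TrialState (n + 1) L) (A : Set Space) (i : Fin (n + 1)) :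
    (∫⁻ X, A.indicator (fun _ => (1 : ℝ≥0∞)) (X i) * (‖Ψ.ψ X‖₊ : ℝ≥0∞) ^ 2) =
      ∫⁻ X, A.indicator (fun _ => (1 : ℝ≥0∞)) (X 0) * (‖Ψ.ψ X‖₊ : ℝ≥0∞) ^ 2 := by
  rw [← lintegral_comp_perm (Equiv.swap 0 i)
    (fun X => A.indicator (fun _ => (1 : ℝ≥0∞)) (X 0) * (‖Ψ.ψ X‖₊ : ℝ≥0∞) ^ 2)]
  refine lintegral_congr fun X => ?_
  simp only [Function.comp_apply, Equiv.swap_apply_left, Ψ.symm]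

/-- **Bose symmetry**: `∫ 1_{nonIso i} |Ψ|² = ∫ 1_{nonIso 0} |Ψ|²`. [folklore] -/
theorem lintegral_nonIso_eq (Ψ : TrialState (n + 1) L) (A : Set Space) (R : ℝ) (i : Fin (n + 1)) :
    (∫⁻ X, {X : Config (n + 1) | X i ∈ A ∧ ∃ i', i' ≠ i ∧ X i' ∈ A ∧ dist (X i) (X i') < R}.indicator
        (fun _ => (1 : ℝ≥0∞)) X * (‖Ψ.ψ X‖₊ : ℝ≥0∞) ^ 2) =
      ∫⁻ X, {X : Config (n + 1) | X 0 ∈ A ∧ ∃ i', i' ≠ 0 ∧ X i' ∈ A ∧ dist (X 0) (X i') < R}.indicator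
        (fun _ => (1 : ℝ≥0∞)) X * (‖Ψ.ψ X‖₊ : ℝ≥0∞) ^ 2 := by
  rw [← lintegral_comp_perm (Equiv.swap 0 i)
    (fun X => {X : Config (n + 1) | X 0 ∈ A ∧ ∃ i', i' ≠ 0 ∧ X i' ∈ A ∧ dist (X 0) (X i') < R}.indicator
      (fun _ => (1 : ℝ≥0∞)) X * (‖Ψ.ψ X‖₊ : ℝ≥0∞) ^ 2)]
  refine lintegral_congr fun X => ?_
  rw [Ψ.symm]
  congr 1
  by_cases h : X ∈ {X : Config (n + 1) | X i ∈ A ∧ ∃ i', i' ≠ i ∧ X i' ∈ A ∧ dist (X i) (X i') < R}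
  · rw [indicator_of_mem h, indicator_of_mem ((comp_swap_mem_nonIso_iff A R i X).2 h)]
  · rw [indicator_of_notMem h, indicator_of_notMem (mt (comp_swap_mem_nonIso_iff A R i X).1 h)]

/-- **The integrated count.** If every configuration has at most `γ` particles isolated in `A`, then
`(n+1) P(X 0 ∈ A) ≤ (n+1) P(0 non-isolated in A) + γ`. [folklore] -/
theorem card_mul_lintegral_le (Ψ : TrialState (n + 1) L) {A : Set Space} (hA : MeasurableSet A)
    (R γ : ℝ)
    (hγ : ∀ X : Config (n + 1),
      ∑ i, {X : Config (n + 1) | X i ∈ A ∧ ∀ i', i' ≠ i → X i' ∈ A → R ≤ dist (X i) (X i')}.indicator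
        (fun _ => (1 : ℝ≥0∞)) X ≤ ENNReal.ofReal γ) :
    ((n + 1 : ℕ) : ℝ≥0∞) *
        (∫⁻ X, A.indicator (fun _ => (1 : ℝ≥0∞)) (X 0) * (‖Ψ.ψ X‖₊ : ℝ≥0∞) ^ 2) ≤
      ((n + 1 : ℕ) : ℝ≥0∞) *
          (∫⁻ X, {X : Config (n + 1) | X 0 ∈ A ∧
              ∃ i', i' ≠ 0 ∧ X i' ∈ A ∧ dist (X 0) (X i') < R}.indicator
            (fun _ => (1 : ℝ≥0∞)) X * (‖Ψ.ψ X‖₊ : ℝ≥0∞) ^ 2) +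
        ENNReal.ofReal γ := by
  have hwm : Measurable fun X : Config (n + 1) => (‖Ψ.ψ X‖₊ : ℝ≥0∞) ^ 2 :=
    measurable_normSq Ψ.contDiff.continuous
  have hAm : ∀ i : Fin (n + 1), Measurable fun X : Config (n + 1) =>
      A.indicator (fun _ => (1 : ℝ≥0∞)) (X i) * (‖Ψ.ψ X‖₊ : ℝ≥0∞) ^ 2 :=
    fun i => ((measurable_const.indicator hA).comp (measurable_pi_apply i)).mul hwm
  have hNm : ∀ i : Fin (n + 1), Measurable fun X : Config (n + 1) =>
      {X : Config (n + 1) | X i ∈ A ∧ ∃ i', i' ≠ i ∧ X i' ∈ A ∧ dist (X i) (X i') < R}.indicator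
        (fun _ => (1 : ℝ≥0∞)) X * (‖Ψ.ψ X‖₊ : ℝ≥0∞) ^ 2 :=
    fun i => (measurable_const.indicator (measurableSet_nonIso hA R i)).mul hwm
  -- the pointwise bound, weighted by `|Ψ|²`
  have hpt : ∀ X : Config (n + 1),
      ∑ i, A.indicator (fun _ => (1 : ℝ≥0∞)) (X i) * (‖Ψ.ψ X‖₊ : ℝ≥0∞) ^ 2 ≤
        (∑ i, {X : Config (n + 1) | X i ∈ A ∧ ∃ i', i' ≠ i ∧ X i' ∈ A ∧ dist (X i) (X i') < R}.indicator
            (fun _ => (1 : ℝ≥0∞)) X * (‖Ψ.ψ X‖₊ : ℝ≥0∞) ^ 2) +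
          ENNReal.ofReal γ * (‖Ψ.ψ X‖₊ : ℝ≥0∞) ^ 2 := by
    intro X
    rw [← Finset.sum_mul, ← Finset.sum_mul, ← add_mul]
    gcongr ?_ * _
    exact (sum_indicator_apply_le A R X).trans (add_le_add le_rfl (hγ X))
  calc ((n + 1 : ℕ) : ℝ≥0∞) *
        (∫⁻ X, A.indicator (fun _ => (1 : ℝ≥0∞)) (X 0) * (‖Ψ.ψ X‖₊ : ℝ≥0∞) ^ 2)
      = ∑ i : Fin (n + 1),
          (∫⁻ X, A.indicator (fun _ => (1 : ℝ≥0∞)) (X i) * (‖Ψ.ψ X‖₊ : ℝ≥0∞) ^ 2) := by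
        simp only [lintegral_indicator_apply_eq Ψ A, Finset.sum_const, Finset.card_univ,
          Fintype.card_fin, nsmul_eq_mul]
    _ = ∫⁻ X, ∑ i : Fin (n + 1), A.indicator (fun _ => (1 : ℝ≥0∞)) (X i) * (‖Ψ.ψ X‖₊ : ℝ≥0∞) ^ 2 :=
        (lintegral_finsetSum _ fun i _ => hAm i).symm
    _ ≤ ∫⁻ X, ((∑ i, {X : Config (n + 1) | X i ∈ A ∧
            ∃ i', i' ≠ i ∧ X i' ∈ A ∧ dist (X i) (X i') < R}.indicator
              (fun _ => (1 : ℝ≥0∞)) X * (‖Ψ.ψ X‖₊ : ℝ≥0∞) ^ 2) +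
          ENNReal.ofReal γ * (‖Ψ.ψ X‖₊ : ℝ≥0∞) ^ 2) := lintegral_mono hpt
    _ = (∑ i : Fin (n + 1), (∫⁻ X, {X : Config (n + 1) | X i ∈ A ∧
            ∃ i', i' ≠ i ∧ X i' ∈ A ∧ dist (X i) (X i') < R}.indicator
              (fun _ => (1 : ℝ≥0∞)) X * (‖Ψ.ψ X‖₊ : ℝ≥0∞) ^ 2)) +
          ENNReal.ofReal γ * (∫⁻ X, (‖Ψ.ψ X‖₊ : ℝ≥0∞) ^ 2) := by
        rw [lintegral_add_right _ (hwm.const_mul _), lintegral_finsetSum _ fun i _ => hNm i,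
          lintegral_const_mul _ hwm]
    _ = ((n + 1 : ℕ) : ℝ≥0∞) * (∫⁻ X, {X : Config (n + 1) | X 0 ∈ A ∧
            ∃ i', i' ≠ 0 ∧ X i' ∈ A ∧ dist (X 0) (X i') < R}.indicator
              (fun _ => (1 : ℝ≥0∞)) X * (‖Ψ.ψ X‖₊ : ℝ≥0∞) ^ 2) +
          ENNReal.ofReal γ := by
        simp only [lintegral_nonIso_eq Ψ A R, Finset.sum_const, Finset.card_univ, Fintype.card_fin,
          nsmul_eq_mul, Ψ.norm_eq, mul_one]

end State

end SymmCount

/-- **Registered stub `stub_symmCount`** (SYMMETRISED COUNTING): if every configuration has at most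
`γ` particles isolated in `A` (in `A`, all other particles of `A` at distance `≥ R`), then
`(n+1) P(X 0 ∈ A) ≤ (n+1) P(X 0 ∈ A, some X_{j+1} ∈ A with |X 0 − X_{j+1}| < R) + γ` in the state
`|Ψ|² dX` of an `(n+1)`-boson wave function `Ψ`. [folklore] -/
theorem stub_symmCount :
    ∀ (n : ℕ) (L : ℝ) (Ψ : Literature.MathematicalPhysics.QuantumManyBody.BoseGas.TrialState (n + 1) L)
      (A : Set (EuclideanSpace ℝ (Fin 3))), MeasurableSet A → ∀ (R γ : ℝ), 0 ≤ γ →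
      (∀ X : Literature.MathematicalPhysics.QuantumManyBody.BoseGas.Config (n + 1),
        (∑ i : Fin (n + 1),
          ({X : Literature.MathematicalPhysics.QuantumManyBody.BoseGas.Config (n + 1) |
              X i ∈ A ∧ ∀ i' : Fin (n + 1), i' ≠ i → X i' ∈ A → R ≤ dist (X i) (X i')}).indicator
            (fun _ => (1 : ENNReal)) X) ≤ ENNReal.ofReal γ) →
      ((n + 1 : ℕ) : ENNReal) * ∫⁻ X : Literature.MathematicalPhysics.QuantumManyBody.BoseGas.Config (n + 1),
          A.indicator (fun _ => (1 : ENNReal)) (X 0) * (‖Ψ.ψ X‖₊ : ENNReal) ^ 2 ≤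
        (((n + 1 : ℕ) : ENNReal) * ∫⁻ X : Literature.MathematicalPhysics.QuantumManyBody.BoseGas.Config (n + 1),
          ({X : Literature.MathematicalPhysics.QuantumManyBody.BoseGas.Config (n + 1) |
              X 0 ∈ A ∧ ∃ j : Fin n, X j.succ ∈ A ∧ dist (X 0) (X j.succ) < R}).indicator
            (fun _ => (1 : ENNReal)) X * (‖Ψ.ψ X‖₊ : ENNReal) ^ 2) + ENNReal.ofReal γ := by
  intro n L Ψ A hA R γ _ hγ
  have h := SymmCount.card_mul_lintegral_le Ψ hA R γ hγ
  rwa [SymmCount.nonIso_zero_eq A R] at h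

end Summit.AtomisticToContinuum.BoseEinsteinCondensation.Cruxes.OneBodyEntropyBound.Birth

end
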